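/-
Copyright (c) 2026. All rights reserved.
Released under Apache 2.0 license as described in the file LICENSE.
-/
import Literature.MathematicalPhysics.QuantumFieldTheory.Balaban1983to89.B4StripSumsDeriv

/-!
# B4 Lemma 2.4 (2.36): the Hölder quotient of `∂^{L^{-j}}_μ G_j Q_j^*` along the printed chain (2.49)–(2.51), typed

Reference: T. Bałaban, "Regularity and decay of lattice Green's functions", Commun. Math. Phys. **89** (1983) 571–597
[Balaban1983RegularityDecay]; Lemma 2.4 p. 582 [PDF 12], proof pp. 584–586 [PDF 14–16].  This module continues
`B4StripSums` (the multiplier of `G_jQ_j^*`, (2.48)) and `B4StripSumsDeriv` (the multiplier of `∂^ξ_μ G_jQ_j^*`, first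
half of (2.49)); it treats the Hölder difference quotient (2.36).

PRINTED STATEMENT (p. 582 [PDF 12], verbatim): «**Lemma 2.4.** There exist positive constants c₀, δ₀, and for α < 1, there
exists a constant c₁, such that … (2.36) |x−x′|^{−α}|(∂^{L^{−j}}_μ G_j(□)Q_j^*)(x,y) − (∂^{L^{−j}}_μ G_j(□)Q_j^*)(x′,y)|
≤ c₁e^{−δ₀dist({x,x′},y)}, … for arbitrary non-negative integer j, arbitrary, rectangular parallelepiped □ ⊂ L^{−j}Z^d
built of large blocks, and x, x′ ∈ □, y, y′ ∈ □^{(j)} = □∩Z^d.»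

PRINTED METHOD (p. 585 [PDF 15], (2.49), and p. 586 [PDF 16], (2.51); verbatim where in «…»): the difference of the kernels
at `x` and `x′` is the `l`-sum of (2.48) carrying the extra factor «|x−x′|^{−α}(e^{i(p′+l)·(x−x′)} − 1)» under the
integral ((2.49); «we have assumed that |x′−y| ≤ |x−y|»); the summand is bounded with «|x−x′|^{−α}|e^{i(p′+l)·(x−x′)} − 1|
≤ O(1)|p′+l|^α», «|∂^ξ_μ(p′+l)| ≤ O(1)|p′_μ+l_μ|», the two-sided bounds on `u_j` and on `Δ¹/Δ^ξ`, and summed as «(2.51) …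
≤ O(1) + Σ_{l≠0}O(1)|p′+l|^{α−1}Π_μ(1+|l_μ|)^{−1} ≤ O(1) + O(1)(Σ_{l∈Z}(1+|l_μ|)^{−1−(1−α)/d})^d ≤ O(1), the constant
depends on α < 1.»; finally «Shifting the domain of integration in (2.49) into a complex domain in the direction of the
vector x′−y, we can bound the left hand side of (2.49) by a constant depending on α multiplied by the exponential factor
e^{−δ₀|x′−y|} = e^{−δ₀dist({x,x′},y)}. We get the inequality (2.36).»

WHAT IS TYPED HERE — for the free fine-lattice propagator `G_j = G_j(a, m²)` on `ξℤ^{d+1}`, `ξ = 1/n`, `n = L^j` (the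
operators with boundary conditions of Cor. 2.3 are NOT covered: GAPS G-B4-04).  Write `x = x⁰ + τ/n`, `x′ = x + σ/n`,
`x⁰, y ∈ ℤ^{d+1}`, `τ ∈ {0,…,n−1}^{d+1}`, `σ ∈ ℤ^{d+1}` with `0 < |σ|_∞ ≤ n` (separations `0 < |x − x′|_∞ ≤ 1`).
* §1 `kc`, `norm_D_le`: the centred residue (`l_μ = 2π kc ∈ (−πn, πn]`) and the printed «|∂^ξ_μ(p′+l)| ≤ O(1)|p′_μ+l_μ|»
  in the `n`-uniform form `|D_n(j; z)| ≤ 33 ω_n(j)` for `|Re z| ≤ π + 1/4`, `|Im z| ≤ 1/2`.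
* §2 `efZ`, `PhZ` (`PhZ_n(k;σ;p′) = e^{i(p′+2πk)·σ/n} = e^{i(p′+l)·(x′−x)}`) and `holderFactor_le`: the printed
  «|x−x′|^{−α}|e^{i(p′+l)·(x−x′)} − 1| ≤ O(1)|p′+l|^α» in the `n`-uniform form
  `(n/|σ|_∞)^α |PhZ − 1| ≤ C_H(d) (1 + W_n(k))^{α/2}` on the fat region, `0 ≤ α ≤ 1`.
* §3 `termH`, `GH` — THE MULTIPLIER OF THE HÖLDER QUOTIENT, `GH_{α,n,a,m²,τ,μ,σ}(p′) = (n/|σ|_∞)^α Σ_k (PhZ_k − 1) termD_k`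
  (dictionary with (2.49) in the docstring of `GH`); the bounds `norm_R_le_one_add_W` (`|R_k| ≤ 2C_R/(1+W_n(k))` for EVERY
  `k`), `one_add_W_rpow_le_prod` (the printed even distribution of the gain `|p′+l|^{α−1}` over the coordinates:
  `(1+W)^{−t} ≤ Π_ν ω_n(k_ν)^{−2t/(d+1)}`), `norm_termH_le`, `sum_prod_rpow_le`, `norm_GH_le`: every summand is
  `≤ c⁻¹ K_H Π_ν 24 ω_n(k_ν)^{−s}`, `s = 1 + (1−α)/(d+1)`, and the sum is `≤ (48 ζ(s))^{d+1}` — finite EXACTLY for `α < 1`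
  (the printed exponent «−1−(1−α)/d», printed `d` = our `d+1`, and «the constant depends on α < 1»).
* §4 joint holomorphy, §5 side periodicity (`PhZ_tr`, `GH_tr_side`), §6 `stripRegular_GH`, **`holder248_stripRegular`** and
  **`hkernel248_decay`**: `κ > 0`, `M ≥ 0` with `|latticeKernel GH (x⁰ − y)| ≤ M e^{−κ|x⁰−y|_∞}` for EVERY `n ≥ 1`,
  `a ∈ [a₋,a₊]`, `m² ∈ [0,m²₊]`, `τ`, `μ`, `σ` (`0 < |σ|_∞ ≤ n`) — hypothesis `0 < a₋` only; §7 the torus corollary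
  (`B4TorusKernel`).  Since `dist_∞({x,x′},y) ≤ |x − y|_∞ ≤ |x⁰ − y|_∞ + 1`,
  `e^{−κ|x⁰−y|_∞} ≤ e^{κ} e^{−κ dist_∞({x,x′},y)}`, so this is (2.36) for separations `|x−x′|_∞ ≤ 1`; for `|x−x′|_∞ > 1`
  the quotient is at most `|(∂G)(x,y)| + |(∂G)(x′,y)|` and (2.36) follows from (2.35) (`B4StripSumsDeriv.dkernel248_decay`)
  by the triangle inequality — not restated here.

DIVERGENCE FROM THE PRINTED CHAIN (recorded in the cell's DIVERGENCE.md): (i) the derivative and Hölder bounds are typed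
through the CENTRED residue `kc` because the residues of `B4StripSums` live in `{0,…,n−1}`; (ii) the quadratic gain is
carried as `(1 + W_n(k))^{−1}` for every `k` (no `l = 0` / `l ≠ 0` split) and distributed evenly over all `d+1` coordinates
after `ω_μ ≤ (1+W)^{1/2}` — the printed (2.51) does the same through `|p′_μ+l_μ| ≤ |p′+l|`; (iii) constants: `M` depends on
`d, α, a₋, a₊, m²₊` through `uniformStrip_holds` and `boundGH`, `κ = min(κ₁, 1/(4(d+2)))`; (iv) the decay is stated in
`|x⁰ − y|_∞` (previous paragraph), the printed `dist({x,x′},y)` differs by at most `2`.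

Tags: `[cite: …]` on `PhZ`, `termH`, `GH` (printed objects of (2.49)) and on the headline theorems, whose docstrings say
"proof supplied by the audit along the printed method"; everything else `[folklore]`.
-/

namespace Literature.MathematicalPhysics.QuantumFieldTheory.Balaban1983to89.B4StripSumsHolder

open Complex Finset
open Literature.MathematicalPhysics.QuantumFieldTheory.Balaban1983to89.B4Strip
open Literature.MathematicalPhysics.QuantumFieldTheory.Balaban1983to89.B4StripCauchy
open Literature.MathematicalPhysics.QuantumFieldTheory.Balaban1983to89.B5Strip145Analytic
open Literature.MathematicalPhysics.QuantumFieldTheory.Balaban1983to89.B5Strip145Decay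
open Literature.MathematicalPhysics.QuantumFieldTheory.Balaban1983to89.B4ContourShift
open Literature.MathematicalPhysics.QuantumFieldTheory.Balaban1983to89.B4StripSums
open Literature.MathematicalPhysics.QuantumFieldTheory.Balaban1983to89.B4StripSumsDeriv
open scoped Real

noncomputable section

variable {d : ℕ}

/-! ### §1 One coordinate: the centred residue and the size of the difference-derivative symbol -/

/-- the centred representative of the residue `j ∈ {0,…,n−1}`: `j` if `2j ≤ n`, else `j − n` (`l_μ = 2π kc_n(j) ∈ (−πn, πn]`).
[folklore] -/
def kc (n j : ℕ) : ℤ := if 2 * j ≤ n then (j : ℤ) else (j : ℤ) - n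

/-- `|kc_n(j)| ≤ ω_n(j)` for a residue `j < n`. [folklore] -/
theorem abs_kc_le_omega (n j : ℕ) (hjn : j < n) : |((kc n j : ℤ) : ℝ)| ≤ omega n j := by
  unfold kc omega
  have hj : (j : ℝ) < n := by exact_mod_cast hjn
  split_ifs with h
  · have h' : 2 * (j : ℝ) ≤ n := by exact_mod_cast h
    rw [Int.cast_natCast, abs_of_nonneg (Nat.cast_nonneg j)]
    exact le_min (by linarith) (by linarith)
  · push Not at h
    have h' : (n : ℝ) < 2 * j := by exact_mod_cast h
    rw [Int.cast_sub, Int.cast_natCast, Int.cast_natCast, abs_of_nonpos (by linarith)]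
    exact le_min (by linarith) (by linarith)

/-- centring the residue does not change the fine-lattice character: `e^{i(z+2πj)s/n} = e^{i(z+2π kc_n(j))s/n}`, `s ∈ ℤ`.
[folklore] -/
theorem exp_centred (n j : ℕ) (hn : n ≠ 0) (s : ℤ) (z : ℂ) :
    cexp (I * (z + 2 * π * j) * s / n) = cexp (I * (z + 2 * π * (kc n j : ℂ)) * s / n) := by
  unfold kc
  split_ifs with h
  · rw [Int.cast_natCast]
  · have hn' : (n : ℂ) ≠ 0 := Nat.cast_ne_zero.mpr hn
    rw [show I * (z + 2 * π * j) * s / n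
        = I * (z + 2 * π * (((j : ℤ) - n : ℤ) : ℂ)) * s / n + (s : ℂ) * (2 * π * I) by
      push_cast; field_simp; ring]
    rw [Complex.exp_add, Complex.exp_int_mul_two_pi_mul_I, mul_one]

/-- the size of the centred momentum: `|z + 2π kc_n(j)| ≤ 11 ω_n(j)` for `|Re z| ≤ π + 1/4`, `|Im z| ≤ 1/2`. [folklore] -/
theorem norm_centred_le (n j : ℕ) (hjn : j < n) {z : ℂ} (hre : |z.re| ≤ Real.pi + 1 / 4) (him : |z.im| ≤ 1 / 2) :
    ‖z + 2 * π * (kc n j : ℂ)‖ ≤ 11 * omega n j := by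
  have hω := one_le_omega n j hjn
  have hk := abs_kc_le_omega n j hjn
  have h1 : ‖z‖ ≤ |z.re| + |z.im| := Complex.norm_le_abs_re_add_abs_im z
  have h2 : ‖(2 * π * (kc n j : ℂ))‖ = 2 * Real.pi * |((kc n j : ℤ) : ℝ)| := by
    rw [norm_mul, norm_mul, Complex.norm_two, Complex.norm_real, Real.norm_of_nonneg Real.pi_pos.le,
      Complex.norm_intCast]
  have hπ : Real.pi ≤ 3.15 := Real.pi_lt_d2.le
  calc ‖z + 2 * π * (kc n j : ℂ)‖ ≤ ‖z‖ + ‖(2 * π * (kc n j : ℂ))‖ := norm_add_le _ _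
    _ ≤ (Real.pi + 1 / 4 + 1 / 2) + 2 * Real.pi * omega n j := by
        rw [h2]
        have : 2 * Real.pi * |((kc n j : ℤ) : ℝ)| ≤ 2 * Real.pi * omega n j :=
          mul_le_mul_of_nonneg_left hk (by positivity)
        linarith
    _ ≤ 11 * omega n j := by nlinarith [Real.pi_pos]

/-- **THE PRINTED «|∂^ξ_μ(p′+l)| ≤ O(1)|p′_μ + l_μ|», `n`-UNIFORM FORM**: `|D_n(j; z)| ≤ 33 ω_n(j)` for `|Re z| ≤ π + 1/4`,
`|Im z| ≤ 1/2` (`D_n(j;z) = n(e^{i(z+2πj)/n} − 1)`: centre the residue; `|e^{iu} − 1| ≤ 2|u|` if `|u| ≤ 1`, `≤ 3` else,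
and in the second case `n < 11 ω`). [folklore] -/
theorem norm_D_le (n j : ℕ) (hn : n ≠ 0) (hjn : j < n) {z : ℂ} (hre : |z.re| ≤ Real.pi + 1 / 4)
    (him : |z.im| ≤ 1 / 2) : ‖D n j z‖ ≤ 33 * omega n j := by
  have hnr : (0 : ℝ) < n := by exact_mod_cast Nat.pos_of_ne_zero hn
  have hn1 : (1 : ℝ) ≤ n := by exact_mod_cast Nat.one_le_iff_ne_zero.mpr hn
  have hω := one_le_omega n j hjn
  have hc := norm_centred_le n j hjn hre him
  set u : ℂ := (z + 2 * π * (kc n j : ℂ)) / n with hu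
  have hexp : cexp (I * (z + 2 * π * j) / n) = cexp (I * u) := by
    have h := exp_centred n j hn 1 z
    simp only [Int.cast_one, mul_one] at h
    rw [h, hu, mul_div_assoc]
  have hD : D n j z = n * (cexp (I * u) - 1) := by unfold D; rw [hexp]
  have hnu : ‖u‖ ≤ 11 * omega n j / n := by
    rw [hu, norm_div, Complex.norm_natCast]; exact div_le_div_of_nonneg_right hc hnr.le
  have huim : |u.im| ≤ 1 / 2 := by
    have h1 : u.im = z.im / n := by
      rw [hu, Complex.div_natCast_im]; simp
    rw [h1, abs_div, Nat.abs_cast]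
    exact (div_le_self (abs_nonneg _) hn1).trans him
  rw [hD, norm_mul, Complex.norm_natCast]
  by_cases h1 : ‖I * u‖ ≤ 1
  · have he := Complex.norm_exp_sub_one_le h1
    rw [norm_mul, Complex.norm_I, one_mul] at he
    calc (n : ℝ) * ‖cexp (I * u) - 1‖ ≤ n * (2 * (11 * omega n j / n)) :=
          mul_le_mul_of_nonneg_left (he.trans (by linarith)) hnr.le
      _ = 22 * omega n j := by field_simp; norm_num
      _ ≤ 33 * omega n j := by linarith
  · push Not at h1
    rw [norm_mul, Complex.norm_I, one_mul] at h1
    have hn11 : (n : ℝ) ≤ 11 * omega n j := by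
      have h2 : (1 : ℝ) < 11 * omega n j / n := h1.trans_le hnu
      rw [lt_div_iff₀ hnr] at h2; linarith
    have h3 : ‖cexp (I * u) - 1‖ ≤ 3 := by
      have hre' : (I * u).re = -u.im := by simp [Complex.mul_re]
      have hexpn : ‖cexp (I * u)‖ ≤ 2 := by
        rw [Complex.norm_exp, hre']
        exact (exp_lt_two (by linarith [neg_le_abs u.im])).le
      calc ‖cexp (I * u) - 1‖ ≤ ‖cexp (I * u)‖ + ‖(1 : ℂ)‖ := norm_sub_le _ _
        _ ≤ 2 + 1 := by rw [norm_one]; linarith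
        _ = 3 := by norm_num
    calc (n : ℝ) * ‖cexp (I * u) - 1‖ ≤ n * 3 := mul_le_mul_of_nonneg_left h3 hnr.le
      _ ≤ 33 * omega n j := by linarith

/-! ### §2 The signed fine-lattice character and the Hölder factor -/

/-- the signed fine-lattice character of one coordinate, `e^{i(z + 2πj)s/n}`, `s ∈ ℤ`. [folklore] -/
def efZ (n j : ℕ) (s : ℤ) (z : ℂ) : ℂ := cexp (I * (z + 2 * π * j) * s / n)

/-- `efZ` is `2π`-periodic up to the residue shift `j ↦ j + 1 (mod n)`. [folklore] -/
theorem efZ_add_two_pi (n j : ℕ) (s : ℤ) (hn : n ≠ 0) (z : ℂ) :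
    efZ n j s (z + 2 * π) = efZ n ((j + 1) % n) s z := by
  unfold efZ
  rw [shift_decomp n j z]
  have hn' : (n : ℂ) ≠ 0 := Nat.cast_ne_zero.mpr hn
  have hcast : (((((j + 1) / n : ℕ) : ℤ) * s : ℤ) : ℂ) = (((j + 1) / n : ℕ) : ℂ) * (s : ℂ) := by
    rw [Int.cast_mul, Int.cast_natCast]
  rw [show I * (z + 2 * π * (((j + 1) % n : ℕ) : ℂ) + 2 * π * n * (((j + 1) / n : ℕ) : ℂ)) * s / n
      = I * (z + 2 * π * (((j + 1) % n : ℕ) : ℂ)) * s / n + (((j + 1) / n : ℕ) : ℂ) * (s : ℂ) * (2 * π * I) by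
      field_simp]
  rw [Complex.exp_add, ← hcast, Complex.exp_int_mul_two_pi_mul_I, mul_one]

/-- `efZ` is entire. [folklore] -/
theorem differentiable_efZ (n j : ℕ) (s : ℤ) : Differentiable ℂ (efZ n j s) := by
  unfold efZ; fun_prop

/-- `|e^{i(z+2πj)s/n}| ≤ 2` for `|s| ≤ n`, `|Im z| ≤ 1/2`. [folklore] -/
theorem norm_efZ_le (n j : ℕ) {s : ℤ} (hs : |s| ≤ n) {z : ℂ} (him : |z.im| ≤ 1 / 2) : ‖efZ n j s z‖ ≤ 2 := by
  unfold efZ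
  rw [Complex.norm_exp]
  refine (exp_lt_two ?_).le
  have hre : (I * (z + 2 * π * j) * s / n).re = -(z.im * s / n) := by
    simp [Complex.mul_re, Complex.mul_im, mul_div_assoc]
  rw [hre]
  rcases Nat.eq_zero_or_pos n with h0 | hpos
  · subst h0; simp
  · have hnr : (0 : ℝ) < n := by exact_mod_cast hpos
    have hs' : |(s : ℝ)| ≤ n := by
      rw [← Int.cast_abs]; exact_mod_cast hs
    have h1 : |z.im * s / n| ≤ 1 / 2 := by
      rw [abs_div, abs_mul, Nat.abs_cast, div_le_iff₀ hnr]
      calc |z.im| * |(s : ℝ)| ≤ (1 / 2) * n := mul_le_mul him hs' (abs_nonneg _) (by norm_num)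
        _ = 1 / 2 * n := rfl
    linarith [neg_le_abs (z.im * s / n)]

/-- the signed multi-coordinate character `PhZ_n(k; σ; p′) = Π_ν e^{i(p′_ν+2πk_ν)σ_ν/n} = e^{i(p′+l)·σ/n}`, `l = 2πk` — the
printed factor `e^{i(p′+l)·(x′−x)}` of (2.49) for `x′ − x = σ/n`. [cite: Balaban1983RegularityDecay, (2.49) p.585] -/
def PhZ (n : ℕ) (k : Fin d → Fin n) (σ : Fin d → ℤ) (p : Fin d → ℂ) : ℂ := ∏ ν, efZ n (k ν : ℕ) (σ ν) (p ν)

/-- `|PhZ| ≤ 2^d` on the fat region when `|σ_ν| ≤ n`. [folklore] -/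
theorem norm_PhZ_le (n : ℕ) (k : Fin d → Fin n) {σ : Fin d → ℤ} (hσ : ∀ ν, |σ ν| ≤ n) {r : ℝ} (hr : r ≤ 1 / 4)
    {p : Fin d → ℂ} (hp : p ∈ Fat d r) : ‖PhZ n k σ p‖ ≤ 2 ^ d := by
  unfold PhZ
  rw [norm_prod]
  calc ∏ ν, ‖efZ n (k ν : ℕ) (σ ν) (p ν)‖ ≤ ∏ _ν : Fin d, (2 : ℝ) :=
        Finset.prod_le_prod (fun _ _ => norm_nonneg _)
          (fun ν _ => norm_efZ_le n _ (hσ ν) (by linarith [(hp ν).2]))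
    _ = 2 ^ d := by simp

/-- `PhZ` as ONE exponential of the centred phase: `PhZ = exp(i Σ_ν (p′_ν + 2π kc_n(k_ν)) σ_ν / n)`. [folklore] -/
theorem PhZ_eq_exp_centred (n : ℕ) (hn : n ≠ 0) (k : Fin d → Fin n) (σ : Fin d → ℤ) (p : Fin d → ℂ) :
    PhZ n k σ p = cexp (∑ ν, I * (p ν + 2 * π * (kc n (k ν) : ℂ)) * σ ν / n) := by
  unfold PhZ efZ
  rw [Complex.exp_sum]
  exact Finset.prod_congr rfl (fun ν _ => exp_centred n (k ν) hn (σ ν) (p ν))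

/-- the centred phase is small: `|Σ_ν (p′_ν + 2π kc_ν) σ_ν / n| ≤ 11 (|σ|_∞/n) Σ_ν ω_n(k_ν)` on the fat region. [folklore] -/
theorem norm_centredPhase_le (n : ℕ) [NeZero n] (k : Fin (d + 1) → Fin n) (σ : Fin (d + 1) → ℤ) {r : ℝ}
    (hr : r ≤ 1 / 4) {p : Fin (d + 1) → ℂ} (hp : p ∈ Fat (d + 1) r) :
    ‖∑ ν, I * (p ν + 2 * π * (kc n (k ν) : ℂ)) * σ ν / n‖ ≤ 11 * (supNorm σ / n) * ∑ ν, omega n (k ν) := by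
  have hnr : (0 : ℝ) < n := by exact_mod_cast Nat.pos_of_ne_zero (NeZero.ne n)
  calc ‖∑ ν, I * (p ν + 2 * π * (kc n (k ν) : ℂ)) * σ ν / n‖
      ≤ ∑ ν, ‖I * (p ν + 2 * π * (kc n (k ν) : ℂ)) * σ ν / n‖ := norm_sum_le _ _
    _ ≤ ∑ ν, 11 * omega n (k ν) * (supNorm σ / n) := by
        refine Finset.sum_le_sum (fun ν _ => ?_)
        rw [norm_div, norm_mul, norm_mul, Complex.norm_I, one_mul, Complex.norm_natCast, Complex.norm_intCast,
          ← Int.cast_abs]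
        have h1 := norm_centred_le n (k ν) (k ν).isLt (z := p ν) (by linarith [(hp ν).1]) (by linarith [(hp ν).2])
        have h2 := abs_le_supNorm σ ν
        have hω : 0 ≤ omega n (k ν) := (omega_pos n _ (k ν).isLt).le
        have h3 : ‖p ν + 2 * π * (kc n (k ν) : ℂ)‖ * (((|σ ν| : ℤ)) : ℝ) ≤ 11 * omega n (k ν) * supNorm σ :=
          mul_le_mul h1 h2 (by positivity) (by positivity)
        calc ‖p ν + 2 * π * (kc n (k ν) : ℂ)‖ * (((|σ ν| : ℤ)) : ℝ) / n
            ≤ 11 * omega n (k ν) * supNorm σ / n := div_le_div_of_nonneg_right h3 hnr.le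
          _ = 11 * omega n (k ν) * (supNorm σ / n) := by ring
    _ = 11 * (supNorm σ / n) * ∑ ν, omega n (k ν) := by
        rw [Finset.mul_sum]; exact Finset.sum_congr rfl (fun ν _ => by ring)

/-- the Hölder constant `C_H(d) = 44 · 2^{d+1} · (d+1)`. [folklore] -/
def CH (d : ℕ) : ℝ := 44 * 2 ^ (d + 1) * ((d : ℝ) + 1)

/-- `C_H(d) ≥ 0`. [folklore] -/
theorem CH_nonneg (d : ℕ) : 0 ≤ CH d := by unfold CH; positivity

/-- `ω_n(k_ν)² ≤ 1 + W_n(k)` for EVERY `k` and `ν`. [folklore] -/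
theorem omega_sq_le_one_add_W (n : ℕ) [NeZero n] (k : Fin d → Fin n) (ν : Fin d) :
    omega n (k ν) ^ 2 ≤ 1 + W n k := by
  by_cases hk : k = fun _ => 0
  · have hn : 1 ≤ n := Nat.one_le_iff_ne_zero.mpr (NeZero.ne n)
    have hW := W_nonneg n k
    have hkν : (k ν : ℕ) = 0 := by rw [hk, Fin.val_zero]
    rw [hkν, omega_zero n hn]; linarith
  · linarith [omega_sq_le_W n k hk ν]

/-- `ω_n(k_ν) ≤ √(1 + W_n(k))`. [folklore] -/
theorem omega_le_sqrt (n : ℕ) [NeZero n] (k : Fin d → Fin n) (ν : Fin d) :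
    omega n (k ν) ≤ Real.sqrt (1 + W n k) :=
  (le_abs_self _).trans (Real.abs_le_sqrt (omega_sq_le_one_add_W n k ν))

/-- a non-zero integer vector has `|σ|_∞ ≥ 1`. [folklore] -/
theorem one_le_supNorm {σ : Fin (d + 1) → ℤ} (hσ0 : σ ≠ 0) : 1 ≤ supNorm σ := by
  obtain ⟨i, hi⟩ := Function.ne_iff.mp hσ0
  have h1 : (1 : ℤ) ≤ |σ i| := Int.one_le_abs hi
  have h2 : ((1 : ℤ) : ℝ) ≤ ((|σ i| : ℤ) : ℝ) := by exact_mod_cast h1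
  simpa using h2.trans (abs_le_supNorm σ i)

/-- **THE PRINTED «|x−x′|^{−α}|e^{i(p′+l)·(x−x′)} − 1| ≤ O(1)|p′+l|^α», `n`-UNIFORM FORM.**  On the fat region `F_r`
(`r ≤ 1/4`), for `σ ≠ 0` with `|σ_ν| ≤ n` and `0 ≤ α ≤ 1`:
`(n/|σ|_∞)^α |PhZ_n(k;σ;p′) − 1| ≤ C_H(d) (1 + W_n(k))^{α/2}`
(`|e^{B} − 1| ≤ 2|B|` for `|B| ≤ 1` and `≤ 2^{d+1} + 1` always; `|B| ≤ 11(|σ|_∞/n) Σ_ν ω_ν`; `ω_ν ≤ (1+W)^{1/2}`; in the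
large case `n/|σ|_∞ < 11 Σ_ν ω_ν`). [folklore] -/
theorem holderFactor_le (n : ℕ) [NeZero n] (k : Fin (d + 1) → Fin n) {σ : Fin (d + 1) → ℤ} (hσ0 : σ ≠ 0)
    (hσn : ∀ ν, |σ ν| ≤ n) {α : ℝ} (hα0 : 0 ≤ α) (hα1 : α ≤ 1) {r : ℝ} (hr : r ≤ 1 / 4)
    {p : Fin (d + 1) → ℂ} (hp : p ∈ Fat (d + 1) r) :
    ((n : ℝ) / supNorm σ) ^ α * ‖PhZ n k σ p - 1‖ ≤ CH d * (1 + W n k) ^ (α / 2) := by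
  have hn0 : n ≠ 0 := NeZero.ne n
  have hnr : (0 : ℝ) < n := by exact_mod_cast Nat.pos_of_ne_zero hn0
  have hS1 : 1 ≤ supNorm σ := one_le_supNorm hσ0
  have hS : 0 < supNorm σ := by linarith
  have hd0 : (0 : ℝ) ≤ d := Nat.cast_nonneg d
  have h2d : (1 : ℝ) ≤ 2 ^ (d + 1) := one_le_pow₀ (by norm_num)
  set B : ℂ := ∑ ν, I * (p ν + 2 * π * (kc n (k ν) : ℂ)) * σ ν / n with hB
  have hPhZ : PhZ n k σ p = cexp B := PhZ_eq_exp_centred n hn0 k σ p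
  set X : ℝ := ∑ ν, omega n (k ν) with hX
  have hX0 : 0 ≤ X := Finset.sum_nonneg (fun ν _ => (omega_pos n _ (k ν).isLt).le)
  have hBle : ‖B‖ ≤ 11 * (supNorm σ / n) * X := norm_centredPhase_le n k σ hr hp
  set P : ℝ := 1 + W n k with hP
  have hP1 : 1 ≤ P := by have := W_nonneg n k; linarith
  have hP0 : 0 ≤ P := by linarith
  have hPα : 0 ≤ P ^ (α / 2) := Real.rpow_nonneg hP0 _
  have hXP : X ≤ ((d : ℝ) + 1) * Real.sqrt P := by
    calc X = ∑ ν, omega n (k ν) := rfl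
      _ ≤ ∑ _ν : Fin (d + 1), Real.sqrt P := Finset.sum_le_sum (fun ν _ => omega_le_sqrt n k ν)
      _ = ((d : ℝ) + 1) * Real.sqrt P := by
          simp only [Finset.sum_const, Finset.card_univ, Fintype.card_fin, nsmul_eq_mul]; push_cast; ring
  have hkey : (11 * X) ^ α ≤ 11 * ((d : ℝ) + 1) * P ^ (α / 2) := by
    have h1 : (11 * X) ^ α ≤ (11 * ((d : ℝ) + 1) * Real.sqrt P) ^ α :=
      Real.rpow_le_rpow (by positivity) (by nlinarith [hXP]) hα0
    have h2 : (11 * ((d : ℝ) + 1) * Real.sqrt P) ^ α = (11 * ((d : ℝ) + 1)) ^ α * (Real.sqrt P) ^ α :=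
      Real.mul_rpow (by positivity) (Real.sqrt_nonneg _)
    have h3 : (11 * ((d : ℝ) + 1)) ^ α ≤ 11 * ((d : ℝ) + 1) := by
      have h1d : (1 : ℝ) ≤ 11 * ((d : ℝ) + 1) := by linarith
      calc (11 * ((d : ℝ) + 1)) ^ α ≤ (11 * ((d : ℝ) + 1)) ^ (1 : ℝ) :=
            Real.rpow_le_rpow_of_exponent_le h1d hα1
        _ = 11 * ((d : ℝ) + 1) := Real.rpow_one _
    have h4 : (Real.sqrt P) ^ α = P ^ (α / 2) := by
      rw [Real.sqrt_eq_rpow, ← Real.rpow_mul hP0]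
      congr 1; ring
    rw [h2, h4] at h1
    exact h1.trans (mul_le_mul_of_nonneg_right h3 hPα)
  rw [hPhZ]
  by_cases hB1 : ‖B‖ ≤ 1
  · have he : ‖cexp B - 1‖ ≤ 2 * ‖B‖ := Complex.norm_exp_sub_one_le hB1
    have hBα : ‖B‖ ≤ ‖B‖ ^ α := by
      calc ‖B‖ = ‖B‖ ^ (1 : ℝ) := (Real.rpow_one _).symm
        _ ≤ ‖B‖ ^ α := Real.rpow_le_rpow_of_exponent_ge' (norm_nonneg _) hB1 hα0 hα1
    have hBα' : ‖B‖ ^ α ≤ (supNorm σ / n) ^ α * (11 * X) ^ α := by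
      rw [← Real.mul_rpow (by positivity) (by positivity)]
      exact Real.rpow_le_rpow (norm_nonneg _) (by nlinarith [hBle]) hα0
    have hcancel : ((n : ℝ) / supNorm σ) ^ α * (supNorm σ / n) ^ α = 1 := by
      rw [← Real.mul_rpow (by positivity) (by positivity), div_mul_div_comm, mul_comm (n : ℝ) (supNorm σ),
        div_self (by positivity), Real.one_rpow]
    have hcoef : 2 * (11 * ((d : ℝ) + 1)) ≤ CH d := by unfold CH; nlinarith
    calc ((n : ℝ) / supNorm σ) ^ α * ‖cexp B - 1‖
        ≤ ((n : ℝ) / supNorm σ) ^ α * (2 * ((supNorm σ / n) ^ α * (11 * X) ^ α)) := by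
          apply mul_le_mul_of_nonneg_left _ (Real.rpow_nonneg (by positivity) _)
          linarith [he, hBα, hBα']
      _ = 2 * (((n : ℝ) / supNorm σ) ^ α * (supNorm σ / n) ^ α) * (11 * X) ^ α := by ring
      _ = 2 * (11 * X) ^ α := by rw [hcancel, mul_one]
      _ ≤ 2 * (11 * ((d : ℝ) + 1) * P ^ (α / 2)) := by linarith [hkey]
      _ = (2 * (11 * ((d : ℝ) + 1))) * P ^ (α / 2) := by ring
      _ ≤ CH d * P ^ (α / 2) := mul_le_mul_of_nonneg_right hcoef hPα
  · push Not at hB1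
    have hratio : (n : ℝ) / supNorm σ ≤ 11 * X := by
      have h1 : 1 < 11 * (supNorm σ / n) * X := hB1.trans_le hBle
      rw [div_le_iff₀ hS]
      have h2 : 11 * (supNorm σ / n) * X = (11 * X * supNorm σ) / n := by ring
      rw [h2, lt_div_iff₀ hnr, one_mul] at h1
      exact h1.le
    have hratioα : ((n : ℝ) / supNorm σ) ^ α ≤ 11 * ((d : ℝ) + 1) * P ^ (α / 2) :=
      (Real.rpow_le_rpow (by positivity) hratio hα0).trans hkey
    have hnormle : ‖cexp B - 1‖ ≤ 2 ^ (d + 1) + 1 := by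
      calc ‖cexp B - 1‖ ≤ ‖cexp B‖ + ‖(1 : ℂ)‖ := norm_sub_le _ _
        _ ≤ 2 ^ (d + 1) + 1 := by
            rw [norm_one, ← hPhZ]
            linarith [norm_PhZ_le n k hσn hr hp]
    have hcoef : 11 * ((d : ℝ) + 1) * (2 ^ (d + 1) + 1) ≤ CH d := by unfold CH; nlinarith
    calc ((n : ℝ) / supNorm σ) ^ α * ‖cexp B - 1‖
        ≤ (11 * ((d : ℝ) + 1) * P ^ (α / 2)) * (2 ^ (d + 1) + 1) :=
          mul_le_mul hratioα hnormle (norm_nonneg _) (by positivity)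
      _ = (11 * ((d : ℝ) + 1) * (2 ^ (d + 1) + 1)) * P ^ (α / 2) := by ring
      _ ≤ CH d * P ^ (α / 2) := mul_le_mul_of_nonneg_right hcoef hPα

/-! ### §3 The multiplier of the Hölder quotient and its `n`-uniform bound -/

/-- `W_n(0) = 0`. [folklore] -/
theorem W_zero (n : ℕ) [NeZero n] : W n (fun _ : Fin d => (0 : Fin n)) = 0 := by
  unfold W; simp

/-- `|R_k| ≤ 2 C_R(d, m²)/(1 + W_n(k))` on the fat region, for EVERY `k` (`R_0 = 1`, `W_n(0) = 0`; for `k ≠ 0`, `W ≥ 1` and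
`B4StripSums.norm_R_le`) — the quadratic gain without an `l = 0` / `l ≠ 0` case split. [folklore] -/
theorem norm_R_le_one_add_W (n : ℕ) [NeZero n] (m2 : ℝ) (hm : 0 ≤ m2) {r : ℝ} (hr : r ≤ 1 / 4)
    (hdr : (d : ℝ) * r ^ 2 ≤ 1 / 16) {q : Fin d → ℂ} (hq : q ∈ Fat d r) (k : Fin d → Fin n) :
    ‖R n m2 k q‖ ≤ 2 * CR d m2 / (1 + W n k) := by
  have hd0 : (0 : ℝ) ≤ d := Nat.cast_nonneg d
  have hCR1 : 1 ≤ CR d m2 := by unfold CR; nlinarith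
  by_cases hk : k = fun _ => 0
  · subst hk
    rw [W_zero]
    unfold R
    rw [if_pos rfl, norm_one]
    norm_num; linarith
  · have hW1 := one_le_W n k hk
    have h1 := norm_R_le n m2 hm hr hdr hq k hk
    have hA : (0 : ℝ) ≤ (16 * d + m2) * (64 / 7) := by nlinarith
    have hACR : (16 * d + m2) * (64 / 7) ≤ CR d m2 := by unfold CR; linarith
    calc ‖R n m2 k q‖ ≤ (16 * d + m2) * (64 / 7) / W n k := h1
      _ ≤ 2 * CR d m2 / (1 + W n k) := by
          rw [div_le_div_iff₀ (by linarith) (by linarith)]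
          nlinarith [mul_le_mul_of_nonneg_right hACR (by linarith : (0 : ℝ) ≤ W n k),
            mul_nonneg hA (by linarith : (0 : ℝ) ≤ W n k - 1)]

/-- **THE EVEN DISTRIBUTION OF THE GAIN** (the printed `|p′+l|^{α−1} ↦ Π_μ (1+|l_μ|)^{−(1−α)/d}` of (2.51)): for `t ≥ 0`,
`(1 + W_n(k))^{−t} ≤ Π_ν ω_n(k_ν)^{−2t/(d+1)}` (each `ω_ν² ≤ 1 + W`). [folklore] -/
theorem one_add_W_rpow_le_prod (n : ℕ) [NeZero n] (k : Fin (d + 1) → Fin n) {t : ℝ} (ht : 0 ≤ t) :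
    (1 + W n k) ^ (-t) ≤ ∏ ν, omega n (k ν) ^ (-(2 * t / ((d : ℝ) + 1))) := by
  have hP : 0 < 1 + W n k := by have := W_nonneg n k; linarith
  have hd1 : (0 : ℝ) < (d : ℝ) + 1 := by positivity
  have hsplit : (1 + W n k) ^ (-t) = ∏ _ν : Fin (d + 1), (1 + W n k) ^ (-t / ((d : ℝ) + 1)) := by
    rw [Finset.prod_const, Finset.card_univ, Fintype.card_fin, ← Real.rpow_natCast, ← Real.rpow_mul hP.le]
    congr 1; push_cast; field_simp
  rw [hsplit]
  refine Finset.prod_le_prod (fun ν _ => Real.rpow_nonneg hP.le _) (fun ν _ => ?_)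
  have hω := omega_pos n _ (k ν).isLt
  have hexp : -t / ((d : ℝ) + 1) ≤ 0 := div_nonpos_of_nonpos_of_nonneg (by linarith) hd1.le
  calc (1 + W n k) ^ (-t / ((d : ℝ) + 1)) ≤ (omega n (k ν) ^ 2) ^ (-t / ((d : ℝ) + 1)) :=
        Real.rpow_le_rpow_of_nonpos (pow_pos hω 2) (omega_sq_le_one_add_W n k ν) hexp
    _ = omega n (k ν) ^ (-(2 * t / ((d : ℝ) + 1))) := by
        rw [← Real.rpow_natCast, ← Real.rpow_mul hω.le]
        congr 1; push_cast; ring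

/-- one term of the `l`-sum of (2.49) (regrouped): `(PhZ_k − 1) · termD_k = (e^{i(p′+l)·(x′−x)} − 1) ∂^ξ_μ(p′+l) e^{i(p′+l)·ξτ}
u_j(p′+l) R_k(p′)/E(p′)`, `l = 2πk`. [cite: Balaban1983RegularityDecay, (2.49) p.585 (regrouped by the audit)] -/
def termH (n : ℕ) [NeZero n] (a m2 : ℝ) (τ : Fin d → Fin n) (μ : Fin d) (σ : Fin d → ℤ) (k : Fin d → Fin n)
    (p : Fin d → ℂ) : ℂ :=
  (PhZ n k σ p - 1) * termD n a m2 τ μ k p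

/-- THE FOURIER MULTIPLIER OF THE HÖLDER QUOTIENT OF `∂^ξ_μ G_j Q_j^*`:
`GH_{α,n,a,m²,τ,μ,σ}(p′) = (n/|σ|_∞)^α Σ_{k ∈ {0..n-1}^{d+1}} (e^{i(p′+2πk)·σ/n} − 1) n(e^{i(p′_μ+2πk_μ)/n} − 1)
e^{i(p′+2πk)·τ/n} u(p′+2πk) R_k(p′)/E(p′)`.  DICTIONARY WITH (2.49): for `x = x⁰ + τ/n`, `x′ = x + σ/n`, `x⁰, y ∈ ℤ^{d+1}`,
`0 < |σ|_∞ ≤ n`, one has `e^{i(p′+l)·(x′−y)} − e^{i(p′+l)·(x−y)} = (e^{i(p′+l)·σ/n} − 1) e^{i(p′+l)·(x−y)}` and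
`|x′ − x|_∞ = |σ|_∞/n`, so the sup-norm Hölder quotient `|x′−x|_∞^{−α}[(∂^ξ_μ G_jQ_j^*)(x′,y) − (∂^ξ_μ G_jQ_j^*)(x,y)]`
is `(2π)^{-(d+1)} ∫_{[-π,π]^{d+1}} GH(p′) e^{ip′·(x⁰−y)} dp′ = latticeKernel GH (x⁰ − y)` (the printed (2.49) is written
at the base point `x′` with `|x′−y| ≤ |x−y|`; exchanging the names of `x`, `x′` changes the quotient by a sign only).
[cite: Balaban1983RegularityDecay, (2.36) p.582 with (2.49) p.585 (regrouped by the audit)] -/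
def GH (α : ℝ) (n : ℕ) [NeZero n] (a m2 : ℝ) (τ : Fin (d + 1) → Fin n) (μ : Fin (d + 1)) (σ : Fin (d + 1) → ℤ)
    (p : Fin (d + 1) → ℂ) : ℂ :=
  ((((n : ℝ) / supNorm σ) ^ α : ℝ) : ℂ) * ∑ k : Fin (d + 1) → Fin n, termH n a m2 τ μ σ k p

/-- the summability exponent `s_H(α, d) = 1 + (1−α)/(d+1)` (printed: `1 + (1−α)/d` with the printed `d` = our `d+1`).
[folklore] -/
def sH (α : ℝ) (d : ℕ) : ℝ := 1 + (1 - α) / ((d : ℝ) + 1)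

/-- `s_H > 1` EXACTLY when `α < 1` (the printed «the constant depends on α < 1»). [folklore] -/
theorem one_lt_sH {α : ℝ} (hα1 : α < 1) (d : ℕ) : 1 < sH α d := by
  unfold sH
  have hd1 : (0 : ℝ) < (d : ℝ) + 1 := by positivity
  have : 0 < (1 - α) / ((d : ℝ) + 1) := div_pos (by linarith) hd1
  linarith

/-- **THE BOUND OF ONE HÖLDER-WEIGHTED TERM** on the fat region (`r ≤ 1/4`, `(d+1)r² ≤ 1/16`), where `|E(p′)| ≥ c > 0`,
`σ ≠ 0`, `|σ_ν| ≤ n`, `0 ≤ α ≤ 1`: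
`(n/|σ|_∞)^α |termH_k(p′)| ≤ c⁻¹ · C_H(d) · 33 · 2C_R(d+1,m²) · Π_ν 24 ω_n(k_ν)^{-s_H(α,d)}`
(`holderFactor_le` × `norm_D_le` × `norm_F_le` × `norm_R_le_one_add_W`, then `(1+W)^{α/2}(1+W)^{1/2}(1+W)^{-1} =
(1+W)^{-(1-α)/2}` and `one_add_W_rpow_le_prod`). [folklore] -/
theorem norm_termH_le (n : ℕ) [NeZero n] (a m2 : ℝ) (hm : 0 ≤ m2) {r : ℝ} (hr : r ≤ 1 / 4)
    (hdr : ((d + 1 : ℕ) : ℝ) * r ^ 2 ≤ 1 / 16) {p : Fin (d + 1) → ℂ} (hp : p ∈ Fat (d + 1) r) {c : ℝ}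
    (hc : 0 < c) (hE : c ≤ ‖E n a m2 p‖) (τ : Fin (d + 1) → Fin n) (μ : Fin (d + 1)) {σ : Fin (d + 1) → ℤ}
    (hσ0 : σ ≠ 0) (hσn : ∀ ν, |σ ν| ≤ n) {α : ℝ} (hα0 : 0 ≤ α) (hα1 : α ≤ 1) (k : Fin (d + 1) → Fin n) :
    ((n : ℝ) / supNorm σ) ^ α * ‖termH n a m2 τ μ σ k p‖
      ≤ c⁻¹ * (CH d * 33 * (2 * CR (d + 1) m2)) * ∏ ν, 24 * omega n (k ν) ^ (-(sH α d)) := by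
  have hP1 : 1 ≤ 1 + W n k := by have := W_nonneg n k; linarith
  have hP0 : 0 < 1 + W n k := by linarith
  have hCR := CR_nonneg (d + 1) hm
  have hCH := CH_nonneg d
  -- the five factors
  have hH := holderFactor_le n k hσ0 hσn hα0 hα1 hr hp
  have hDle : ‖D n (k μ : ℕ) (p μ)‖ ≤ 33 * Real.sqrt (1 + W n k) :=
    (norm_D_le n (k μ) (NeZero.ne n) (k μ).isLt (by linarith [(hp μ).1]) (by linarith [(hp μ).2])).trans
      (mul_le_mul_of_nonneg_left (omega_le_sqrt n k μ) (by norm_num))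
  have hF := norm_F_le n hr τ k hp
  have hR := norm_R_le_one_add_W n m2 hm hr hdr hp k
  have hE' : ‖E n a m2 p‖⁻¹ ≤ c⁻¹ := inv_anti₀ hc hE
  have hprodF0 : 0 ≤ ∏ ν, 24 / omega n (k ν) :=
    Finset.prod_nonneg (fun ν _ => div_nonneg (by norm_num) (omega_pos n _ (k ν).isLt).le)
  have hR0' : 0 ≤ 2 * CR (d + 1) m2 / (1 + W n k) := div_nonneg (by linarith) hP0.le
  have hsplit_norm : ‖termH n a m2 τ μ σ k p‖
      = ‖PhZ n k σ p - 1‖ * (‖D n (k μ : ℕ) (p μ)‖ * (‖F n τ k p‖ * ‖R n m2 k p‖ * ‖E n a m2 p‖⁻¹)) := by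
    unfold termH termD term
    rw [norm_mul, norm_mul, norm_div, norm_mul, div_eq_mul_inv]
  -- the product of the bounds
  have step1 : ((n : ℝ) / supNorm σ) ^ α * ‖termH n a m2 τ μ σ k p‖
      ≤ (CH d * (1 + W n k) ^ (α / 2)) * ((33 * Real.sqrt (1 + W n k))
          * ((∏ ν, 24 / omega n (k ν)) * (2 * CR (d + 1) m2 / (1 + W n k)) * c⁻¹)) := by
    rw [hsplit_norm, ← mul_assoc]
    have hin : ‖F n τ k p‖ * ‖R n m2 k p‖ * ‖E n a m2 p‖⁻¹
        ≤ (∏ ν, 24 / omega n (k ν)) * (2 * CR (d + 1) m2 / (1 + W n k)) * c⁻¹ :=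
      mul_le_mul (mul_le_mul hF hR (norm_nonneg _) hprodF0) hE' (inv_nonneg.mpr (norm_nonneg _))
        (mul_nonneg hprodF0 hR0')
    have hmid : ‖D n (k μ : ℕ) (p μ)‖ * (‖F n τ k p‖ * ‖R n m2 k p‖ * ‖E n a m2 p‖⁻¹)
        ≤ (33 * Real.sqrt (1 + W n k)) * ((∏ ν, 24 / omega n (k ν)) * (2 * CR (d + 1) m2 / (1 + W n k)) * c⁻¹) :=
      mul_le_mul hDle hin (by positivity) (by positivity)
    exact mul_le_mul hH hmid (by positivity) (mul_nonneg hCH (Real.rpow_nonneg hP0.le _))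
  -- the powers of `1 + W` combine to `(1+W)^{-(1-α)/2}`
  have halg : (1 + W n k) ^ (α / 2) * Real.sqrt (1 + W n k) / (1 + W n k) = (1 + W n k) ^ (-((1 - α) / 2)) := by
    rw [Real.sqrt_eq_rpow, ← Real.rpow_add hP0, div_eq_mul_inv, ← Real.rpow_neg_one (1 + W n k),
      ← Real.rpow_add hP0]
    congr 1; ring
  have hgain : (1 + W n k) ^ (-((1 - α) / 2)) ≤ ∏ ν, omega n (k ν) ^ (-(2 * ((1 - α) / 2) / ((d : ℝ) + 1))) :=
    one_add_W_rpow_le_prod n k (by linarith)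
  have hgain0 : 0 ≤ (1 + W n k) ^ (-((1 - α) / 2)) := Real.rpow_nonneg hP0.le _
  have step2 : (CH d * (1 + W n k) ^ (α / 2)) * ((33 * Real.sqrt (1 + W n k))
          * ((∏ ν, 24 / omega n (k ν)) * (2 * CR (d + 1) m2 / (1 + W n k)) * c⁻¹))
      = c⁻¹ * (CH d * 33 * (2 * CR (d + 1) m2))
          * (((1 + W n k) ^ (α / 2) * Real.sqrt (1 + W n k) / (1 + W n k)) * ∏ ν, 24 / omega n (k ν)) := by
    field_simp
  have hfac : (∏ ν, omega n (k ν) ^ (-(2 * ((1 - α) / 2) / ((d : ℝ) + 1)))) * ∏ ν, 24 / omega n (k ν)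
      = ∏ ν, 24 * omega n (k ν) ^ (-(sH α d)) := by
    rw [← Finset.prod_mul_distrib]
    refine Finset.prod_congr rfl (fun ν _ => ?_)
    have hω := omega_pos n _ (k ν).isLt
    have h24 : (24 : ℝ) / omega n (k ν) = 24 * omega n (k ν) ^ (-1 : ℝ) := by
      rw [Real.rpow_neg_one, div_eq_mul_inv]
    rw [h24, show omega n (k ν) ^ (-(2 * ((1 - α) / 2) / ((d : ℝ) + 1)))
        * (24 * omega n (k ν) ^ (-1 : ℝ)) = 24 * (omega n (k ν) ^ (-(2 * ((1 - α) / 2) / ((d : ℝ) + 1)))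
        * omega n (k ν) ^ (-1 : ℝ)) by ring, ← Real.rpow_add hω]
    congr 2
    unfold sH
    field_simp
    ring
  calc ((n : ℝ) / supNorm σ) ^ α * ‖termH n a m2 τ μ σ k p‖
      ≤ c⁻¹ * (CH d * 33 * (2 * CR (d + 1) m2))
          * (((1 + W n k) ^ (α / 2) * Real.sqrt (1 + W n k) / (1 + W n k)) * ∏ ν, 24 / omega n (k ν)) := by
        rw [← step2]; exact step1
    _ = c⁻¹ * (CH d * 33 * (2 * CR (d + 1) m2)) * ((1 + W n k) ^ (-((1 - α) / 2)) * ∏ ν, 24 / omega n (k ν)) := by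
        rw [halg]
    _ ≤ c⁻¹ * (CH d * 33 * (2 * CR (d + 1) m2))
          * ((∏ ν, omega n (k ν) ^ (-(2 * ((1 - α) / 2) / ((d : ℝ) + 1)))) * ∏ ν, 24 / omega n (k ν)) := by
        apply mul_le_mul_of_nonneg_left (mul_le_mul_of_nonneg_right hgain hprodF0)
        positivity
    _ = c⁻¹ * (CH d * 33 * (2 * CR (d + 1) m2)) * ∏ ν, 24 * omega n (k ν) ^ (-(sH α d)) := by rw [hfac]

/-- the residue sum factorises: `Σ_{k ∈ ℤ_n^m} Π_i 24 ω_n(k_i)^{-s} = (Σ_j 24 ω_n(j)^{-s})^m ≤ (48 ζ(s))^m`, `s > 1`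
(`B4StripSumsDeriv.sum_omega_rpow_le_zetaS`). [folklore] -/
theorem sum_prod_rpow_le (n m : ℕ) {s : ℝ} (hs : 1 < s) :
    ∑ k : Fin m → Fin n, ∏ i, 24 * omega n (k i) ^ (-s) ≤ (48 * zetaS s) ^ m := by
  have h := Finset.prod_univ_sum (fun _ : Fin m => (Finset.univ : Finset (Fin n)))
    (fun _ j => 24 * omega n (j : ℕ) ^ (-s))
  rw [Fintype.piFinset_univ] at h
  rw [← h]
  have hS : ∑ j : Fin n, 24 * omega n (j : ℕ) ^ (-s) ≤ 48 * zetaS s := by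
    rw [← Finset.mul_sum]
    have := sum_omega_rpow_le_zetaS n hs
    linarith
  have hS0 : 0 ≤ ∑ j : Fin n, 24 * omega n (j : ℕ) ^ (-s) :=
    Finset.sum_nonneg (fun j _ => mul_nonneg (by norm_num) (Real.rpow_nonneg (omega_pos n j j.isLt).le _))
  calc ∏ _i : Fin m, ∑ j : Fin n, 24 * omega n (j : ℕ) ^ (-s)
      ≤ ∏ _i : Fin m, (48 * zetaS s) := Finset.prod_le_prod (fun _ _ => hS0) (fun _ _ => hS)
    _ = (48 * zetaS s) ^ m := by simp

/-- the uniform bound `M_H(d, α, c, m²₊) = c⁻¹ · C_H(d) · 33 · 2C_R(d+1, m²₊) · (48 ζ(s_H(α,d)))^{d+1}` of the Hölder multiplier.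
[folklore] -/
def boundGH (d : ℕ) (α c m2plus : ℝ) : ℝ :=
  c⁻¹ * (CH d * 33 * (2 * CR (d + 1) m2plus)) * (48 * zetaS (sH α d)) ^ (d + 1)

/-- the uniform bound is `≥ 0`. [folklore] -/
theorem boundGH_nonneg (d : ℕ) (α : ℝ) {c m2plus : ℝ} (hc : 0 < c) (hm : 0 ≤ m2plus) : 0 ≤ boundGH d α c m2plus := by
  unfold boundGH
  have := CR_nonneg (d + 1) hm
  have := zetaS_nonneg (sH α d)
  have := CH_nonneg d
  positivity

/-- **THE UNIFORM BOUND OF THE HÖLDER MULTIPLIER ON THE FAT REGION**: where `|E(p′)| ≥ c > 0`, for `σ ≠ 0`, `|σ_ν| ≤ n`,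
`0 ≤ α < 1`: `|GH_{α,n,a,m²,τ,μ,σ}(p′)| ≤ boundGH d α c m²₊` — independent of `n = L^j`, `τ`, `μ`, `σ`, `a`, and of
`m² ∈ [0, m²₊]` (the printed (2.51)). [folklore] -/
theorem norm_GH_le (n : ℕ) [NeZero n] (a m2 m2plus : ℝ) (hm : 0 ≤ m2) (hmp : m2 ≤ m2plus)
    {r : ℝ} (hr : r ≤ 1 / 4) (hdr : ((d + 1 : ℕ) : ℝ) * r ^ 2 ≤ 1 / 16) {p : Fin (d + 1) → ℂ}
    (hp : p ∈ Fat (d + 1) r) {c : ℝ} (hc : 0 < c) (hE : c ≤ ‖E n a m2 p‖) (τ : Fin (d + 1) → Fin n)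
    (μ : Fin (d + 1)) {σ : Fin (d + 1) → ℤ} (hσ0 : σ ≠ 0) (hσn : ∀ ν, |σ ν| ≤ n) {α : ℝ} (hα0 : 0 ≤ α)
    (hα1 : α < 1) : ‖GH α n a m2 τ μ σ p‖ ≤ boundGH d α c m2plus := by
  unfold GH boundGH
  have hρ : 0 ≤ ((n : ℝ) / supNorm σ) ^ α :=
    Real.rpow_nonneg (div_nonneg (Nat.cast_nonneg n) (supNorm_nonneg σ)) _
  rw [norm_mul, Complex.norm_real, Real.norm_of_nonneg hρ]
  have hCR := CR_nonneg (d + 1) hm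
  have hCH := CH_nonneg d
  have hK : 0 ≤ c⁻¹ * (CH d * 33 * (2 * CR (d + 1) m2)) := by positivity
  calc ((n : ℝ) / supNorm σ) ^ α * ‖∑ k : Fin (d + 1) → Fin n, termH n a m2 τ μ σ k p‖
      ≤ ((n : ℝ) / supNorm σ) ^ α * ∑ k : Fin (d + 1) → Fin n, ‖termH n a m2 τ μ σ k p‖ :=
        mul_le_mul_of_nonneg_left (norm_sum_le _ _) hρ
    _ = ∑ k : Fin (d + 1) → Fin n, ((n : ℝ) / supNorm σ) ^ α * ‖termH n a m2 τ μ σ k p‖ := by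
        rw [Finset.mul_sum]
    _ ≤ ∑ k : Fin (d + 1) → Fin n,
          c⁻¹ * (CH d * 33 * (2 * CR (d + 1) m2)) * ∏ ν, 24 * omega n (k ν) ^ (-(sH α d)) :=
        Finset.sum_le_sum (fun k _ => norm_termH_le n a m2 hm hr hdr hp hc hE τ μ hσ0 hσn hα0 hα1.le k)
    _ = c⁻¹ * (CH d * 33 * (2 * CR (d + 1) m2))
          * ∑ k : Fin (d + 1) → Fin n, ∏ ν, 24 * omega n (k ν) ^ (-(sH α d)) := by
        rw [Finset.mul_sum]
    _ ≤ c⁻¹ * (CH d * 33 * (2 * CR (d + 1) m2)) * (48 * zetaS (sH α d)) ^ (d + 1) :=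
        mul_le_mul_of_nonneg_left (sum_prod_rpow_le n (d + 1) (one_lt_sH hα1 d)) hK
    _ ≤ c⁻¹ * (CH d * 33 * (2 * CR (d + 1) m2plus)) * (48 * zetaS (sH α d)) ^ (d + 1) := by
        have h1 := CR_mono (d + 1) hmp
        have h2 : 0 ≤ (48 * zetaS (sH α d)) ^ (d + 1) := by have := zetaS_nonneg (sH α d); positivity
        have h4 : 0 ≤ c⁻¹ := by positivity
        have h3 : c⁻¹ * (CH d * 33 * (2 * CR (d + 1) m2)) ≤ c⁻¹ * (CH d * 33 * (2 * CR (d + 1) m2plus)) :=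
          mul_le_mul_of_nonneg_left (by nlinarith) h4
        exact mul_le_mul_of_nonneg_right h3 h2

/-! ### §4 Joint holomorphy of the Hölder multiplier on the fat region -/

/-- `PhZ_n(k;σ;·)` is entire on `ℂ^d` (jointly). [folklore] -/
theorem differentiableAt_PhZ (n : ℕ) (k : Fin d → Fin n) (σ : Fin d → ℤ) (q : Fin d → ℂ) :
    DifferentiableAt ℂ (PhZ n k σ) q := by
  unfold PhZ
  apply dAt_finset_prod
  intro ν _
  exact DifferentiableAt.comp (g := efZ n (k ν) (σ ν)) (f := fun p : Fin d → ℂ => p ν) q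
    ((differentiable_efZ n (k ν) (σ ν)) (q ν)) (differentiableAt_apply (𝕜 := ℂ) ν q)

/-- one Hölder-weighted term is holomorphic (jointly) at every point of the fat region where `E ≠ 0`. [folklore] -/
theorem differentiableAt_termH (n : ℕ) [NeZero n] (a m2 : ℝ) (hm : 0 ≤ m2) {r : ℝ} (hr : r ≤ 1 / 4)
    (hdr : (d : ℝ) * r ^ 2 ≤ 1 / 16) {q : Fin d → ℂ} (hq : q ∈ Fat d r) (hE : E n a m2 q ≠ 0)
    (τ : Fin d → Fin n) (μ : Fin d) (σ : Fin d → ℤ) (k : Fin d → Fin n) :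
    DifferentiableAt ℂ (termH n a m2 τ μ σ k) q := by
  show DifferentiableAt ℂ (fun p => (PhZ n k σ p - 1) * termD n a m2 τ μ k p) q
  exact ((differentiableAt_PhZ n k σ q).sub (differentiableAt_const _)).mul
    (differentiableAt_termD n a m2 hm hr hdr hq hE τ μ k)

/-- **THE HÖLDER MULTIPLIER IS HOLOMORPHIC (jointly) at every point of the fat region where `E ≠ 0`.** [folklore] -/
theorem differentiableAt_GH (n : ℕ) [NeZero n] (a m2 : ℝ) (hm : 0 ≤ m2) {r : ℝ} (hr : r ≤ 1 / 4)
    (hdr : ((d + 1 : ℕ) : ℝ) * r ^ 2 ≤ 1 / 16) {q : Fin (d + 1) → ℂ} (hq : q ∈ Fat (d + 1) r)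
    (hE : E n a m2 q ≠ 0) (τ : Fin (d + 1) → Fin n) (μ : Fin (d + 1)) (σ : Fin (d + 1) → ℤ) (α : ℝ) :
    DifferentiableAt ℂ (GH α n a m2 τ μ σ) q := by
  show DifferentiableAt ℂ (fun p => ((((n : ℝ) / supNorm σ) ^ α : ℝ) : ℂ)
    * ∑ k : Fin (d + 1) → Fin n, termH n a m2 τ μ σ k p) q
  apply DifferentiableAt.const_mul
  apply DifferentiableAt.fun_sum
  intro k _
  exact differentiableAt_termH n a m2 hm hr hdr hq hE τ μ σ k

/-! ### §5 Periodicity across the sides of the strip -/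

/-- the signed character relabels under `2π`-shifts: `PhZ_n(k; σ; p + 2π e_{μ′}) = PhZ_n(σ_{μ′} k; σ; p)`. [folklore] -/
theorem PhZ_tr (n : ℕ) [NeZero n] (k : Fin d → Fin n) (σ : Fin d → ℤ) (p : Fin d → ℂ) (μ' : Fin d) :
    PhZ n k σ (tr p μ') = PhZ n (sigma n μ' k) σ p := by
  unfold PhZ
  refine Finset.prod_congr rfl (fun ν _ => ?_)
  by_cases h : ν = μ'
  · subst h
    rw [tr_apply_self, sigma_apply_self, val_add_one_eq_mod, efZ_add_two_pi _ _ _ (NeZero.ne n)]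
  · rw [tr_apply_of_ne h, sigma_apply_of_ne n h]

/-- **SIDE PERIODICITY OF ONE HÖLDER-WEIGHTED TERM**: at a strip point with `Re p_{μ′} = −π` and `E ≠ 0` at `p` and at
`p + 2π e_{μ′}`, `termH_k(p + 2π e_{μ′}) = termH_{σ_{μ′} k}(p)`. [folklore] -/
theorem termH_tr_side (n : ℕ) [NeZero n] (a m2 : ℝ) (hm : 0 ≤ m2) {κ : ℝ} (hκ1 : κ ≤ 1)
    (hdκ : (d : ℝ) * κ ^ 2 ≤ 1 / 16) {p : Fin d → ℂ} (hp : p ∈ Strip d κ) (μ' : Fin d)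
    (hre : (p μ').re = -Real.pi) (hE0 : E n a m2 p ≠ 0) (hE1 : E n a m2 (tr p μ') ≠ 0)
    (τ : Fin d → Fin n) (μ : Fin d) (σ : Fin d → ℤ) (k : Fin d → Fin n) :
    termH n a m2 τ μ σ k (tr p μ') = termH n a m2 τ μ σ (sigma n μ' k) p := by
  unfold termH
  rw [PhZ_tr, termD_tr_side n a m2 hm hκ1 hdκ hp μ' hre hE0 hE1 τ μ k]

/-- **SIDE PERIODICITY OF THE HÖLDER MULTIPLIER**: `GH(p + 2π e_{μ′}) = GH(p)` at the strip points with `Re p_{μ′} = −π`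
(relabel the `l`-sum by `σ_{μ′}`; the Hölder weight `(n/|σ|_∞)^α` does not depend on `p′`). [folklore] -/
theorem GH_tr_side (n : ℕ) [NeZero n] (a m2 : ℝ) (hm : 0 ≤ m2) {κ : ℝ} (hκ1 : κ ≤ 1)
    (hdκ : ((d + 1 : ℕ) : ℝ) * κ ^ 2 ≤ 1 / 16) {p : Fin (d + 1) → ℂ} (hp : p ∈ Strip (d + 1) κ) (μ' : Fin (d + 1))
    (hre : (p μ').re = -Real.pi) (hE0 : E n a m2 p ≠ 0) (hE1 : E n a m2 (tr p μ') ≠ 0)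
    (τ : Fin (d + 1) → Fin n) (μ : Fin (d + 1)) (σ : Fin (d + 1) → ℤ) (α : ℝ) :
    GH α n a m2 τ μ σ (tr p μ') = GH α n a m2 τ μ σ p := by
  unfold GH
  congr 1
  calc ∑ k : Fin (d + 1) → Fin n, termH n a m2 τ μ σ k (tr p μ')
      = ∑ k : Fin (d + 1) → Fin n, termH n a m2 τ μ σ (sigma n μ' k) p :=
        Finset.sum_congr rfl (fun k _ => termH_tr_side n a m2 hm hκ1 hdκ hp μ' hre hE0 hE1 τ μ σ k)
    _ = ∑ k : Fin (d + 1) → Fin n, termH n a m2 τ μ σ k p :=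
        Equiv.sum_comp (sigmaEquiv n μ') (fun k => termH n a m2 τ μ σ k p)

/-! ### §6 Assembly: strip regularity of the Hölder multiplier and the decay of the Hölder quotient of the kernel -/

/-- **STRIP REGULARITY OF THE HÖLDER MULTIPLIER** in the sense of `B4ContourShift.StripRegular`: on a strip `Strip (d+1) κ`,
`0 ≤ κ ≤ r = 1/(4(d+2))`, on which `|E| ≥ c > 0`, the multiplier `GH_{α,n,a,m²,τ,μ,σ}` (`σ ≠ 0`, `|σ_ν| ≤ n`, `0 ≤ α < 1`)
is continuous, holomorphic in each coordinate, periodic across the sides, and bounded by `boundGH d α c m²₊` — for EVERY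
`n ≥ 1`, `a`, `m² ∈ [0, m²₊]`, `τ`, `μ`, `σ`. [folklore] -/
theorem stripRegular_GH (n : ℕ) [NeZero n] (a m2 m2plus : ℝ) (hm : 0 ≤ m2) (hmp : m2 ≤ m2plus)
    (τ : Fin (d + 1) → Fin n) (μ : Fin (d + 1)) {σ : Fin (d + 1) → ℤ} (hσ0 : σ ≠ 0) (hσn : ∀ ν, |σ ν| ≤ n)
    {α : ℝ} (hα0 : 0 ≤ α) (hα1 : α < 1) {κ c : ℝ} (hκ0 : 0 ≤ κ) (hκr : κ ≤ rOf (d + 1)) (hc : 0 < c)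
    (hE : ∀ p ∈ Strip (d + 1) κ, c ≤ ‖E n a m2 p‖) :
    StripRegular (d := d) (GH α n a m2 τ μ σ) κ (boundGH d α c m2plus) := by
  obtain ⟨hκ1, hdκ⟩ := kappa_small hκ0 hκr
  have hfat : Strip (d + 1) κ ⊆ Fat (d + 1) (rOf (d + 1)) := strip_subset_fat (rOf_pos _).le hκr
  have hne : ∀ p ∈ Strip (d + 1) κ, E n a m2 p ≠ 0 := by
    intro p hp h
    have := hE p hp
    rw [h, norm_zero] at this
    linarith
  have hdiffAt : ∀ p ∈ Strip (d + 1) κ, DifferentiableAt ℂ (GH α n a m2 τ μ σ) p := fun p hp =>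
    differentiableAt_GH n a m2 hm (rOf_le _) (d_mul_rOf_sq_le _) (hfat hp) (hne p hp) τ μ σ α
  refine ⟨?_, ?_, ?_, ?_⟩
  · exact fun p hp => (hdiffAt p hp).continuousAt.continuousWithinAt
  · intro i q hq z hz
    have hP : i.insertNth z (ofRealVec q) ∈ Strip (d + 1) κ :=
      insertNth_mem_Strip hκ0 i hq (openRect_subset_closedRect κ hz)
    exact ((hdiffAt _ hP).comp z (differentiableAt_insertNth i _ z)).differentiableWithinAt
  · intro i q hq y hy
    obtain ⟨hP, hre⟩ := insertNth_left_mem hκ0 i hq hy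
    rw [← tr_insertNth_left]
    have hP' := tr_mem_Strip hP i hre
    exact (GH_tr_side n a m2 hm hκ1 hdκ hP i hre (hne _ hP) (hne _ hP') τ μ σ α).symm
  · intro p hp
    exact norm_GH_le n a m2 m2plus hm hmp (rOf_le _) (d_mul_rOf_sq_le _) (hfat hp) hc (hE p hp) τ μ hσ0 hσn
      hα0 hα1

/-- **B4 LEMMA 2.4 (2.36) FOR THE FREE PROPAGATOR, MULTIPLIER FORM.**  For `0 < a₋ ≤ a₊`, `m²₊` and `0 ≤ α < 1` there are
`κ > 0` and `M ≥ 0` such that for EVERY `n = L^j ≥ 1`, `a ∈ [a₋, a₊]`, `m² ∈ [0, m²₊]`, every block offset `τ`, every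
direction `μ` and every separation numerator `σ ∈ ℤ^{d+1}` with `0 < |σ|_∞ ≤ n`, the Hölder multiplier
`GH_{α,n,a,m²,τ,μ,σ}` is `StripRegular` on `Strip (d+1) κ` with bound `M`.  ONLY HYPOTHESIS: `0 < a₋`.
[cite: Balaban1983RegularityDecay, Lemma 2.4 (2.36) p.582 with (2.49)–(2.51) pp.585–586; proof supplied by the audit along
the printed method] -/
theorem holder248_stripRegular (d : ℕ) (aminus aplus m2plus : ℝ) (ha : 0 < aminus) {α : ℝ} (hα0 : 0 ≤ α)
    (hα1 : α < 1) :
    ∃ κ M : ℝ, 0 < κ ∧ 0 ≤ M ∧ ∀ (n : ℕ) [NeZero n] (a m2 : ℝ), aminus ≤ a → a ≤ aplus → 0 ≤ m2 →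
      m2 ≤ m2plus → ∀ (τ : Fin (d + 1) → Fin n) (μ : Fin (d + 1)) (σ : Fin (d + 1) → ℤ), σ ≠ 0 →
        (∀ ν, |σ ν| ≤ n) → StripRegular (d := d) (GH α n a m2 τ μ σ) κ M := by
  obtain ⟨κ₁, c, hκ₁, hc, h⟩ := uniformStrip_holds (d + 1) aminus aplus m2plus ha
  refine ⟨min κ₁ (rOf (d + 1)), boundGH d α c (max m2plus 0), lt_min hκ₁ (rOf_pos _),
    boundGH_nonneg _ α hc (le_max_right _ _), ?_⟩
  intro n _ a m2 ha1 ha2 hm hmp τ μ σ hσ0 hσn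
  have hκ0 : 0 ≤ min κ₁ (rOf (d + 1)) := (lt_min hκ₁ (rOf_pos _)).le
  have hsub : Strip (d + 1) (min κ₁ (rOf (d + 1))) ⊆ Strip (d + 1) κ₁ := strip_mono (min_le_left _ _)
  exact stripRegular_GH n a m2 (max m2plus 0) hm (hmp.trans (le_max_left _ _)) τ μ hσ0 hσn hα0 hα1 hκ0
    (min_le_right _ _) hc (fun p hp => h n a m2 ha1 ha2 hm hmp p (hsub hp))

/-- **B4 LEMMA 2.4 (2.36) — THE `j`-UNIFORM EXPONENTIAL DECAY OF THE HÖLDER QUOTIENT OF THE KERNEL OF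
`∂^{L^{-j}}_μ G_j Q_j^*` (free propagator, infinite lattice, separations `0 < |x − x′|_∞ ≤ 1`).**  For `0 < a₋ ≤ a₊`, `m²₊`
and `0 ≤ α < 1` there are `κ > 0`, `M ≥ 0` such that for EVERY `n = L^j ≥ 1`, `a ∈ [a₋, a₊]`, `m² ∈ [0, m²₊]`, every `τ`,
`μ`, every `σ ∈ ℤ^{d+1}` with `0 < |σ|_∞ ≤ n` and every `x ∈ ℤ^{d+1}`:
`|(2π)^{-(d+1)} ∫_{[-π,π]^{d+1}} GH(p′) e^{ip′·x} dp′| ≤ M e^{−κ |x|_∞}`, i.e. (dictionary of `GH`)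
`|x′ − x|_∞^{−α} |(∂^{L^{-j}}_μ G_jQ_j^*)(x′, y) − (∂^{L^{-j}}_μ G_jQ_j^*)(x, y)| ≤ M e^{−κ|x⁰ − y|_∞}` for
`x = x⁰ + τ/n`, `x′ = x + σ/n`, `x⁰, y ∈ ℤ^{d+1}` (and `e^{−κ|x⁰−y|_∞} ≤ e^{κ} e^{−κ dist_∞({x,x′},y)}` since
`dist_∞({x,x′},y) ≤ |x⁰−y|_∞ + 1`).  The constant `M` depends on `α` and is finite only because `α < 1` (the printed
«for α < 1, there exists a constant c₁»).  Assembled from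
`holder248_stripRegular` and the generic engine `B4ContourShift.latticeKernel_decay`.  Not covered here: separations
`|x−x′|_∞ > 1` (which follow from (2.35), `B4StripSumsDeriv.dkernel248_decay`, by the triangle inequality), the operators
with boundary conditions (Cor. 2.3, GAPS G-B4-04), and (2.37).
[cite: Balaban1983RegularityDecay, Lemma 2.4 (2.36) p.582 with (2.49)–(2.51) pp.585–586; proof supplied by the audit
along the printed method] -/
theorem hkernel248_decay (d : ℕ) (aminus aplus m2plus : ℝ) (ha : 0 < aminus) {α : ℝ} (hα0 : 0 ≤ α) (hα1 : α < 1) :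
    ∃ κ M : ℝ, 0 < κ ∧ 0 ≤ M ∧ ∀ (n : ℕ) [NeZero n] (a m2 : ℝ), aminus ≤ a → a ≤ aplus → 0 ≤ m2 →
      m2 ≤ m2plus → ∀ (τ : Fin (d + 1) → Fin n) (μ : Fin (d + 1)) (σ : Fin (d + 1) → ℤ), σ ≠ 0 →
        (∀ ν, |σ ν| ≤ n) → ∀ x : Fin (d + 1) → ℤ,
          ‖latticeKernel (GH α n a m2 τ μ σ) x‖ ≤ M * Real.exp (-(κ * supNorm x)) := by
  obtain ⟨κ, M, hκ, hM, h⟩ := holder248_stripRegular d aminus aplus m2plus ha hα0 hα1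
  refine ⟨κ, M, hκ, hM, ?_⟩
  intro n _ a m2 ha1 ha2 hm hmp τ μ σ hσ0 hσn x
  exact latticeKernel_decay (h n a m2 ha1 ha2 hm hmp τ μ σ hσ0 hσn) hκ.le x

/-- Euclidean form of the decay: rate `κ/√(d+1)` in `|x|_2`. [cite: Balaban1983RegularityDecay, Lemma 2.4 (2.36) p.582;
proof supplied by the audit along the printed method] -/
theorem hkernel248_decay_euclid (d : ℕ) (aminus aplus m2plus : ℝ) (ha : 0 < aminus) {α : ℝ} (hα0 : 0 ≤ α)
    (hα1 : α < 1) :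
    ∃ κ M : ℝ, 0 < κ ∧ 0 ≤ M ∧ ∀ (n : ℕ) [NeZero n] (a m2 : ℝ), aminus ≤ a → a ≤ aplus → 0 ≤ m2 →
      m2 ≤ m2plus → ∀ (τ : Fin (d + 1) → Fin n) (μ : Fin (d + 1)) (σ : Fin (d + 1) → ℤ), σ ≠ 0 →
        (∀ ν, |σ ν| ≤ n) → ∀ x : Fin (d + 1) → ℤ,
          ‖latticeKernel (GH α n a m2 τ μ σ) x‖
            ≤ M * Real.exp (-(κ / Real.sqrt (d + 1) * Real.sqrt (∑ i, ((x i : ℝ)) ^ 2))) := by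
  obtain ⟨κ, M, hκ, hM, h⟩ := holder248_stripRegular d aminus aplus m2plus ha hα0 hα1
  refine ⟨κ, M, hκ, hM, ?_⟩
  intro n _ a m2 ha1 ha2 hm hmp τ μ σ hσ0 hσn x
  exact latticeKernel_decay_euclid (h n a m2 ha1 ha2 hm hmp τ μ σ hσ0 hσn) hκ.le hM x

/-! ### §7 The finite-torus corollary (Poisson periodisation, `B4TorusKernel`) -/

section Torus

open Set UnitAddTorus
open Literature.MathematicalPhysics.QuantumFieldTheory.Balaban1983to89.B4TorusKernel

/-- THE FINITE-TORUS HÖLDER QUOTIENT KERNEL (unit torus `Π_ν ℤ/N_ν` of blocks, fine offset `τ`, direction `μ`, separation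
numerator `σ`, exponent `α`): at block separation `x⁰ ∈ ℤ^{d+1}`,
`(Π_ν N_ν)^{-1} Σ_{k ∈ Π_ν ℤ/N_ν} GH_{α,n,a,m²,τ,μ,σ}(p′_k) e^{i p′_k · x⁰}`, `p′_{k,ν} = 2π rep(k_ν/N_ν)` — by
linearity the `|x′−x|_∞^{-α}`-weighted difference of the torus kernels of `∂^ξ_μ G_jQ_j^*` at `x′` and `x`.
[cite: Balaban1983RegularityDecay, (2.36) p.582 with (2.49) p.585 and p.572 (torus); dictionary] [folklore] -/
def torusKernelH248 (α : ℝ) (n : ℕ) [NeZero n] (a m2 : ℝ) (τ : Fin (d + 1) → Fin n) (μ : Fin (d + 1))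
    (σ : Fin (d + 1) → ℤ) (N : Fin (d + 1) → ℕ) (x : Fin (d + 1) → ℤ) : ℂ :=
  (∏ i, ((N i : ℕ) : ℂ))⁻¹ * ∑ k : (i : Fin (d + 1)) → Fin (N i),
    GH α n a m2 τ μ σ (ofRealVec (fun i => 2 * π * rep (MultiPeriod.gridPt N k i))) * mFourier x (MultiPeriod.gridPt N k)

/-- the finite-torus kernel is the engine's `MultiPeriod.torusKernel` of the descended multiplier (definitional). [folklore] -/
theorem torusKernelH248_eq_torusKernel (α : ℝ) (n : ℕ) [NeZero n] (a m2 : ℝ) (τ : Fin (d + 1) → Fin n)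
    (μ : Fin (d + 1)) (σ : Fin (d + 1) → ℤ) {κ M : ℝ} (hreg : StripRegular (d := d) (GH α n a m2 τ μ σ) κ M)
    (hκ : 0 ≤ κ) (N : Fin (d + 1) → ℕ) (x : Fin (d + 1) → ℤ) :
    torusKernelH248 α n a m2 τ μ σ N x = MultiPeriod.torusKernel (descendC _ hreg hκ) N x := rfl

/-- PERIODICITY: `torusKernelH248 … N (x + (N_ν m_ν)_ν) = torusKernelH248 … N x`. [folklore] -/
theorem torusKernelH248_translate (α : ℝ) (n : ℕ) [NeZero n] (a m2 : ℝ) (τ : Fin (d + 1) → Fin n)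
    (μ : Fin (d + 1)) (σ : Fin (d + 1) → ℤ) {N : Fin (d + 1) → ℕ} (hN : ∀ i, 1 ≤ N i) (x m : Fin (d + 1) → ℤ) :
    torusKernelH248 α n a m2 τ μ σ N (MultiPeriod.translate N x m) = torusKernelH248 α n a m2 τ μ σ N x := by
  unfold torusKernelH248
  congr 1
  exact Finset.sum_congr rfl fun k _ => by rw [MultiPeriod.mFourier_translate_gridPt hN x m k]

/-- for fixed admissible `a > 0`, `m² ≥ 0`, `0 ≤ α < 1` the Hölder multiplier is strip regular with a POSITIVE half-width,
for every `n ≥ 1`, `τ`, `μ`, `σ ≠ 0` with `|σ_ν| ≤ n`. [folklore] -/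
theorem exists_stripRegular_GH {a m2 α : ℝ} (ha : 0 < a) (hm : 0 ≤ m2) (hα0 : 0 ≤ α) (hα1 : α < 1) :
    ∃ κ M : ℝ, 0 < κ ∧ 0 ≤ M ∧ ∀ (n : ℕ) [NeZero n] (τ : Fin (d + 1) → Fin n) (μ : Fin (d + 1))
      (σ : Fin (d + 1) → ℤ), σ ≠ 0 → (∀ ν, |σ ν| ≤ n) → StripRegular (d := d) (GH α n a m2 τ μ σ) κ M := by
  obtain ⟨κ, M, hκ, hM, h⟩ := holder248_stripRegular d a a m2 ha hα0 hα1
  exact ⟨κ, M, hκ, hM, fun n _ τ μ σ hσ0 hσn => h n a m2 le_rfl le_rfl hm le_rfl τ μ σ hσ0 hσn⟩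

/-- the finite-torus Hölder kernel is the periodisation of the infinite-volume one:
`torusKernelH248 α n a m2 τ μ σ N x⁰ = Σ_{m ∈ ℤ^{d+1}} latticeKernel (GH α n a m2 τ μ σ) (x⁰ + (N_ν m_ν)_ν)`.
[cite: Balaban1984PropagatorsI, p. 36 l. 20–23; Balaban1983RegularityDecay (2.36) p.582; proof supplied by the audit, not
printed] -/
theorem torusKernelH248_eq_periodise (n : ℕ) [NeZero n] {a m2 α : ℝ} (ha : 0 < a) (hm : 0 ≤ m2) (hα0 : 0 ≤ α)
    (hα1 : α < 1) (τ : Fin (d + 1) → Fin n) (μ : Fin (d + 1)) {σ : Fin (d + 1) → ℤ} (hσ0 : σ ≠ 0)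
    (hσn : ∀ ν, |σ ν| ≤ n) {N : Fin (d + 1) → ℕ} (hN : ∀ i, 1 ≤ N i) (x : Fin (d + 1) → ℤ) :
    torusKernelH248 α n a m2 τ μ σ N x
      = ∑' m : Fin (d + 1) → ℤ, latticeKernel (GH α n a m2 τ μ σ) (MultiPeriod.translate N x m) := by
  obtain ⟨κ, M, hκ, _, hreg⟩ := exists_stripRegular_GH (d := d) ha hm hα0 hα1
  rw [torusKernelH248_eq_torusKernel α n a m2 τ μ σ (hreg n τ μ σ hσ0 hσn) hκ.le N x]
  exact MultiPeriod.torusKernel_descend_eq (hreg n τ μ σ hσ0 hσn) hκ hN x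

/-- **B4 LEMMA 2.4 (2.36) ON THE TORUS — UNIFORMLY IN `j`, THE MASS, THE OFFSET, THE DIRECTION, THE SEPARATION AND THE
VOLUME.**  For `0 < a₋ ≤ a₊`, `m²₊`, `0 ≤ α < 1` there are `κ > 0` and `M ≥ 0` such that for EVERY `n = L^j ≥ 1`,
`a ∈ [a₋, a₊]`, `m² ∈ [0, m²₊]`, `τ`, `μ`, `σ ≠ 0` with `|σ_ν| ≤ n`, every period vector with all `N_ν ≥ 1` and every
`x⁰ ∈ ℤ^{d+1}`: `‖torusKernelH248 α n a m2 τ μ σ N x⁰‖ ≤ M · periodConst κ d · e^{−(κ/(d+1)) · torusSupNorm N x⁰}`.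
ONLY HYPOTHESIS: `0 < a₋`. [cite: Balaban1983RegularityDecay, Lemma 2.4 (2.36) p.582 with (2.49)–(2.51) pp.585–586 and
p.572 (torus); Balaban1984PropagatorsI p.36 l.20–23; proof supplied by the audit, not printed] -/
theorem hkernel248_torusKernel_decay_torusMetric (d : ℕ) (aminus aplus m2plus : ℝ) (ha : 0 < aminus) {α : ℝ}
    (hα0 : 0 ≤ α) (hα1 : α < 1) :
    ∃ κ M : ℝ, 0 < κ ∧ 0 ≤ M ∧ ∀ (n : ℕ) [NeZero n] (a m2 : ℝ), aminus ≤ a → a ≤ aplus → 0 ≤ m2 →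
      m2 ≤ m2plus → ∀ (τ : Fin (d + 1) → Fin n) (μ : Fin (d + 1)) (σ : Fin (d + 1) → ℤ), σ ≠ 0 →
        (∀ ν, |σ ν| ≤ n) → ∀ (N : Fin (d + 1) → ℕ), (∀ i, 1 ≤ N i) → ∀ x : Fin (d + 1) → ℤ,
          ‖torusKernelH248 α n a m2 τ μ σ N x‖
            ≤ M * periodConst κ d * Real.exp (-(κ / (d + 1) * MultiPeriod.torusSupNorm N x)) := by
  obtain ⟨κ, M, hκ, hM, h⟩ := holder248_stripRegular d aminus aplus m2plus ha hα0 hα1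
  refine ⟨κ, M, hκ, hM, ?_⟩
  intro n _ a m2 ha1 ha2 hm hmp τ μ σ hσ0 hσn N hN x
  have hreg := h n a m2 ha1 ha2 hm hmp τ μ σ hσ0 hσn
  rw [torusKernelH248_eq_torusKernel α n a m2 τ μ σ hreg hκ.le N x]
  exact MultiPeriod.torusKernel_descend_decay_torusMetric hreg hκ hN x

/-- the periodisation series of the Hölder-quotient lattice kernel obeys the same torus bound (consumer form).
[cite: Balaban1984PropagatorsI, p. 36 l. 20–23; proof supplied by the audit, not printed] -/
theorem hkernel248_periodise_decay (d : ℕ) (aminus aplus m2plus : ℝ) (ha : 0 < aminus) {α : ℝ} (hα0 : 0 ≤ α)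
    (hα1 : α < 1) :
    ∃ κ M : ℝ, 0 < κ ∧ 0 ≤ M ∧ ∀ (n : ℕ) [NeZero n] (a m2 : ℝ), aminus ≤ a → a ≤ aplus → 0 ≤ m2 →
      m2 ≤ m2plus → ∀ (τ : Fin (d + 1) → Fin n) (μ : Fin (d + 1)) (σ : Fin (d + 1) → ℤ), σ ≠ 0 →
        (∀ ν, |σ ν| ≤ n) → ∀ (N : Fin (d + 1) → ℕ), (∀ i, 1 ≤ N i) → ∀ x : Fin (d + 1) → ℤ,
          ‖∑' m : Fin (d + 1) → ℤ, latticeKernel (GH α n a m2 τ μ σ) (MultiPeriod.translate N x m)‖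
            ≤ M * periodConst κ d * Real.exp (-(κ / (d + 1) * MultiPeriod.torusSupNorm N x)) := by
  obtain ⟨κ, M, hκ, hM, h⟩ := hkernel248_torusKernel_decay_torusMetric d aminus aplus m2plus ha hα0 hα1
  refine ⟨κ, M, hκ, hM, ?_⟩
  intro n _ a m2 ha1 ha2 hm hmp τ μ σ hσ0 hσn N hN x
  rw [← torusKernelH248_eq_periodise n (lt_of_lt_of_le ha ha1) hm hα0 hα1 τ μ hσ0 hσn hN x]
  exact h n a m2 ha1 ha2 hm hmp τ μ σ hσ0 hσn N hN x

end Torus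

end

end Literature.MathematicalPhysics.QuantumFieldTheory.Balaban1983to89.B4StripSumsHolder
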